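import Mathlib.AlgebraicGeometry.Morphisms.Smooth
import Mathlib.AlgebraicGeometry.Morphisms.Flat
import Mathlib.AlgebraicGeometry.Morphisms.SurjectiveOnStalks
import Mathlib.AlgebraicGeometry.Morphisms.UniversallyClosed
import Mathlib.AlgebraicGeometry.PullbackCarrier
import Mathlib.RingTheory.LocalRing.Module
import Mathlib.RingTheory.Smooth.StandardSmoothCotangent
import HarnessLib

/-!
# Spreading out "smooth of relative dimension `n`" from a flat base change (the generic fibre)

Let `f : X → S` be locally of finite presentation, `i : S' → S` flat and surjective on stalks
(for instance `Spec K → Spec R` for a localization `K` of `R`, such as the fraction field of a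
domain — then `X' = X ×_S S'` is the generic fibre), and suppose the base change
`f' : X' → S'` is smooth of relative dimension `n` (Mathlib `SmoothOfRelativeDimension n`:
locally given by standard smooth ring maps of relative dimension `n`). We prove that every
point of `X` in the image of `X'` has an open neighbourhood `V` with `V → S` smooth of relative
dimension `n` (`Literature.AlgebraicGeometry.Motives.exists_smoothOfRelativeDimension_ι_comp_of_isPullback`), so that
the (open) locus where `f` is smooth of relative dimension `n` contains these fibres. This is the pointwise form, for the "limit"
`S' → S`, of the descent of smoothness and of relative dimension through limits of schemes
(Stacks, Tags 0C0C and 0EY2; EGA IV₄ 17.7.8), and it is the key step of the spreading-out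
theorem `Literature.AlgebraicGeometry.Motives.GoodReductionProofs`.

## The proof

1. Stalks. A flat local homomorphism which is surjective is bijective
   (`injective_of_surjective_of_flat`: `A/I` finite flat over local `A` is free, Mathlib
   `Module.free_of_flat_of_isLocalRing`, hence faithful), so `i` and its base change `X' → X`
   induce isomorphisms on stalks (`isIso_stalkMap_of_flat_of_surjectiveOnStalks`). Hence the
   stalk map of `f` at `x = pr(x')` is isomorphic, as an arrow, to that of `f'` at `x'`, and
   `x` lies in Mathlib's `Scheme.Hom.smoothLocus` of `f` (`mem_smoothLocus_of_isPullback`).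
2. Charts. A point of the smooth locus has an affine chart `Γ(S, U) → Γ(X, V)` which is
   standard smooth of *some* relative dimension `d` (Mathlib `exists_smooth_of_formallySmooth_stalk`,
   `Smooth.exists_isStandardSmooth`), `exists_appLE_isStandardSmoothOfRelativeDimension_of_mem_smoothLocus`.
3. Dimension. The relative dimension of a smooth morphism at a point is well defined
   (`eq_of_smoothOfRelativeDimension`: two charts at a point refine to a common chart
   `Γ(S, D(r)) → Γ(X, D(s))`, whose module of differentials is then free of both ranks over a
   nonzero ring; Mathlib `IsStandardSmoothOfRelativeDimension.rank_kaehlerDifferential`).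
   Base changing the chart of step 2 to `X'` (Mathlib `Scheme.Hom.isPullback_resLE`) gives a
   chart of `f'` of relative dimension `d` at `x'`, so `d = n`
   (`exists_appLE_isStandardSmoothOfRelativeDimension_of_isPullback`).
4. Good locus. `f` is smooth of relative dimension `n` on the union `W` of any family of opens
   on which it is (`smoothOfRelativeDimension_sSup_ι_comp`; the property is local on the
   source), and a base change `X ×_S T → X` landing in such a `W` is smooth of relative
   dimension `n` over `T` (`smoothOfRelativeDimension_of_range_subset`).

## References

* The Stacks project, Tags 0C0C, 0EY2 (smoothness and relative dimension descend through
  limits), 00TA (smooth ⇒ locally standard smooth), 02G2 (smooth of relative dimension `d`),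
  00NZ (finite flat over local is free). [StacksProject]
* A. Grothendieck, EGA IV₄ 17.7.8 (spreading out smoothness from the generic fibre).
-/
universe u

open CategoryTheory AlgebraicGeometry Limits

noncomputable section

namespace Literature.AlgebraicGeometry.Motives

/-! ### Flat local homomorphisms which are surjective are bijective -/

/-- A surjective ring homomorphism `f : A → B` from a local ring onto a nonzero ring which makes
`B` a flat `A`-module is injective: `B ≅ A/I` is finite flat over the local ring `A`, hence free
(Mathlib `Module.free_of_flat_of_isLocalRing`), and a nonzero free module is faithful, so
`I = 0` (Matsumura, *Commutative Ring Theory*, Thm. 7.10; Stacks 00NZ). [folklore] -/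
theorem injective_of_surjective_of_flat {A B : Type*} [CommRing A] [CommRing B] [IsLocalRing A]
    [Nontrivial B] (f : A →+* B) (hf : Function.Surjective f) (hflat : f.Flat) :
    Function.Injective f := by
  algebraize [f]
  haveI : Module.Finite A B :=
    Module.Finite.of_surjective (Algebra.linearMap A B) hf
  haveI : Module.Free A B := Module.free_of_flat_of_isLocalRing
  rw [injective_iff_map_eq_zero]
  intro a ha
  let b := Module.Free.chooseBasis A B
  obtain ⟨i⟩ : Nonempty (Module.Free.ChooseBasisIndex A B) := b.index_nonempty
  have h1 : a • b i = 0 := by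
    rw [Algebra.smul_def, RingHom.algebraMap_toAlgebra, ha, zero_mul]
  have h2 := congr_arg (fun x ↦ b.repr x i) h1
  simpa using h2

/-- For a morphism of schemes which is flat and surjective on stalks (e.g. `Spec S⁻¹R → Spec R`,
or any base change of it), all stalk maps `𝒪_{S, i(s)} → 𝒪_{S', s}` are isomorphisms. [folklore] -/
theorem isIso_stalkMap_of_flat_of_surjectiveOnStalks {S S' : Scheme.{u}} (i : S' ⟶ S) [Flat i]
    [SurjectiveOnStalks i] (s : S') : IsIso (i.stalkMap s) := by
  have hbij : Function.Bijective (i.stalkMap s).hom :=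
    ⟨injective_of_surjective_of_flat _ (i.stalkMap_surjective s) (Flat.stalkMap i s),
      i.stalkMap_surjective s⟩
  exact (RingEquiv.ofBijective _ hbij).toCommRingCatIso.isIso_hom

/-! ### The smooth locus and base change along flat morphisms surjective on stalks -/

section SmoothLocus

variable {X X' S S' : Scheme.{u}} {f : X ⟶ S} {f' : X' ⟶ S'} {pr : X' ⟶ X} {i : S' ⟶ S}

/-- Let `X' = X ×_S S'` where `i : S' → S` is flat and surjective on stalks (so that `i` and its
base change `X' → X` induce isomorphisms on all stalks), `f : X → S` locally of finite
presentation. If the base change `f' : X' → S'` is smooth at `x'` (i.e. `𝒪_{S',f'(x')} → 𝒪_{X',x'}`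
is formally smooth), then `f` is smooth at the image `x` of `x'` in `X`: the stalk map of `f`
at `x` is isomorphic, as an arrow, to that of `f'` at `x'`. [folklore] -/
theorem mem_smoothLocus_of_isPullback (H : IsPullback pr f' f i) [LocallyOfFinitePresentation f]
    [LocallyOfFinitePresentation f'] [Flat i] [SurjectiveOnStalks i] {x' : X'}
    (hx' : x' ∈ f'.smoothLocus) : pr x' ∈ f.smoothLocus := by
  haveI : Flat pr := MorphismProperty.of_isPullback H.flip inferInstance
  haveI : SurjectiveOnStalks pr := MorphismProperty.of_isPullback H.flip inferInstance
  haveI h1 : IsIso (pr.stalkMap x') := isIso_stalkMap_of_flat_of_surjectiveOnStalks pr x'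
  haveI h2 : IsIso (i.stalkMap (f' x')) := isIso_stalkMap_of_flat_of_surjectiveOnStalks i (f' x')
  rw [Scheme.Hom.mem_smoothLocus] at hx' ⊢
  have key := Scheme.Hom.stalkMap_congr_hom (pr ≫ f) (f' ≫ i) H.w x'
  rw [Scheme.Hom.stalkMap_comp, Scheme.Hom.stalkMap_comp] at key
  have heq := congrArg (· ≫ inv (pr.stalkMap x')) key
  simp only [Category.assoc, IsIso.hom_inv_id, Category.comp_id] at heq
  rw [heq]
  refine (RingHom.FormallySmooth.respectsIso.cancel_right_isIso _ _).mpr ?_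
  refine (RingHom.FormallySmooth.respectsIso.cancel_left_isIso _ _).mpr ?_
  exact (RingHom.FormallySmooth.respectsIso.cancel_left_isIso _ _).mpr hx'

end SmoothLocus

/-! ### Charts of standard smooth ring maps of relative dimension `d` -/

section Charts

variable {X S : Scheme.{u}} (f : X ⟶ S)

/-- Restricting a chart to basic opens preserves a property of ring maps which is preserved by
localization and stable under composition with localizations (e.g. standard smooth of relative
dimension `d`): if `Γ(S, U) → Γ(X, V)` has `P`, so does `Γ(S, D(r)) → Γ(X, D(s))` for
`r ∈ Γ(S, U)`, `s ∈ Γ(X, V)` with `D(s) ⊆ f⁻¹ D(r)` (cf. Mathlib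
`exists_basicOpen_le_appLE_of_appLE_of_isAffine`). [folklore] -/
theorem appLE_basicOpen_of_appLE
    {P : ∀ {R T : Type u} [CommRing R] [CommRing T], (R →+* T) → Prop}
    (hPa : RingHom.StableUnderCompositionWithLocalizationAwayTarget P)
    (hPl : RingHom.LocalizationAwayPreserves P)
    (U : S.affineOpens) (V : X.affineOpens) (e : V.1 ≤ f ⁻¹ᵁ U.1) (h : P (f.appLE U V e).hom)
    (r : Γ(S, U)) (s : Γ(X, V)) (e' : X.basicOpen s ≤ f ⁻¹ᵁ S.basicOpen r) :
    P (f.appLE (S.basicOpen r) (X.basicOpen s) e').hom := by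
  set t : Γ(X, V) := f.appLE U V e r with ht
  have hst : X.basicOpen s ≤ X.basicOpen t := by
    rw [ht, Scheme.basicOpen_appLE]
    exact le_inf (X.basicOpen_le s) e'
  set s' : Γ(X, X.basicOpen t) := X.presheaf.map (homOfLE (X.basicOpen_le t)).op s with hs'
  have hss' : X.basicOpen s = X.basicOpen s' := by
    rw [hs', Scheme.basicOpen_res]
    exact (inf_eq_right.mpr hst).symm
  haveI := U.2.isLocalization_basicOpen r
  haveI := V.2.isLocalization_basicOpen t
  haveI := (V.2.basicOpen t).isLocalization_basicOpen s'
  rw [f.appLE_congr e' rfl hss' (fun f => P f.hom)]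
  have heq : f.appLE (S.basicOpen r) (X.basicOpen s') (hss' ▸ e') =
      f.appLE (S.basicOpen r) (X.basicOpen t) (by rw [ht, Scheme.basicOpen_appLE]; exact inf_le_right) ≫
        X.presheaf.map (homOfLE (X.basicOpen_le s')).op := by
    rw [Scheme.Hom.appLE_map]
  rw [heq, CommRingCat.hom_comp]
  refine hPa _ s' _ ?_
  rw [U.2.appLE_eq_away_map f V.2 e r]
  exact hPl _ r _ _ h

/-- A chart `Γ(S, U) → Γ(X, V)` standard smooth of relative dimension `d` makes the restriction
`f|_V : V → U` smooth of relative dimension `d`. [folklore] -/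
theorem SmoothSpread.smoothOfRelativeDimension_resLE {d : ℕ} (U : S.affineOpens) (V : X.affineOpens)
    (e : V.1 ≤ f ⁻¹ᵁ U.1) (h : (f.appLE U V e).hom.IsStandardSmoothOfRelativeDimension d) :
    SmoothOfRelativeDimension d (f.resLE U V e) := by
  haveI : IsAffine V.1 := V.2
  haveI : IsAffine U.1 := U.2
  rw [HasRingHomProperty.iff_of_isAffine (P := @SmoothOfRelativeDimension d)]
  refine ((RingHom.locally_respectsIso (RingHom.isStandardSmoothOfRelativeDimension_respectsIso
    (n := d))).arrow_mk_iso_iff (arrowResLEAppIso f U V e)).mpr ?_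
  exact RingHom.locally_of RingHom.isStandardSmoothOfRelativeDimension_respectsIso _ h

/-- At a point where `f` (locally of finite presentation) is smooth, i.e. `𝒪_{S,f x} → 𝒪_{X,x}` is
formally smooth, there is a chart `Γ(S, U) → Γ(X, V)`, `x ∈ V`, which is standard smooth of
some relative dimension `d` (Mathlib: `exists_smooth_of_formallySmooth_stalk` and
`Smooth.exists_isStandardSmooth`; Stacks 00TA). [folklore] -/
theorem exists_appLE_isStandardSmoothOfRelativeDimension_of_mem_smoothLocus
    [LocallyOfFinitePresentation f] {x : X} (hx : x ∈ f.smoothLocus) :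
    ∃ (d : ℕ) (U : S.affineOpens) (V : X.affineOpens) (_ : x ∈ V.1) (e : V.1 ≤ f ⁻¹ᵁ U.1),
      (f.appLE U V e).hom.IsStandardSmoothOfRelativeDimension d := by
  obtain ⟨U, hU, V, hV, hVU, hxV, hsm⟩ := exists_smooth_of_formallySmooth_stalk f x hx
  haveI : IsAffine V := hV
  haveI : IsAffine U := hU
  have hS : Smooth (f.resLE U V hVU) := by
    rw [HasRingHomProperty.iff_of_isAffine (P := @Smooth)]
    exact (RingHom.Smooth.respectsIso.arrow_mk_iso_iff (arrowResLEAppIso f U V hVU)).mpr hsm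
  obtain ⟨U', hU', V', hV', hxV', e', hstd⟩ :=
    Smooth.exists_isStandardSmooth (f.resLE U V hVU) ⟨x, hxV⟩
  rw [Scheme.Hom.resLE_appLE] at hstd
  set φ := (f.appLE (U.ι ''ᵁ U') (V.ι ''ᵁ V')
    ((Scheme.Hom.le_resLE_preimage_iff f hVU U' V').mp e')).hom with hφ
  have hstd' : φ.IsStandardSmooth := hstd
  algebraize [φ]
  obtain ⟨_, _, _, _, ⟨P⟩⟩ := hstd'
  refine ⟨P.dimension, ⟨U.ι ''ᵁ U', hU'.image_of_isOpenImmersion _⟩,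
    ⟨V.ι ''ᵁ V', hV'.image_of_isOpenImmersion _⟩, ⟨⟨x, hxV⟩, hxV', rfl⟩,
    (Scheme.Hom.le_resLE_preimage_iff f hVU U' V').mp e', ?_⟩
  exact ⟨_, _, _, ‹_›, ⟨P, rfl⟩⟩

/-- The sections of a scheme over an open containing a point form a nonzero ring. [folklore] -/
theorem nontrivial_sections_of_mem {W : X.Opens} {x : X} (hx : x ∈ W) : Nontrivial Γ(X, W) := by
  refine ⟨⟨0, 1, fun h01 ↦ ?_⟩⟩
  have h1 : X.basicOpen (1 : Γ(X, W)) = W := X.basicOpen_of_isUnit isUnit_one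
  have h0 : X.basicOpen (0 : Γ(X, W)) = ⊥ := X.basicOpen_zero W
  rw [← h01, h0] at h1
  rw [← h1] at hx
  exact hx

/-- **Uniqueness of the relative dimension.** If `h : X → S` is smooth of relative dimension `d`
and of relative dimension `n`, and `X` is nonempty, then `d = n`: at a point, refine charts of
the two kinds to a common chart `Γ(S, D(r)) → Γ(X, D(s))`, which is then standard smooth of
relative dimension `d` and `n`, so that `Ω` is free of rank `d` and `n` over the nonzero ring
`Γ(X, D(s))` (Mathlib `IsStandardSmoothOfRelativeDimension.rank_kaehlerDifferential`). [folklore] -/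
theorem SmoothSpread.eq_of_smoothOfRelativeDimension {d n : ℕ} (h : X ⟶ S) [hd : SmoothOfRelativeDimension d h]
    [hn : SmoothOfRelativeDimension n h] (x : X) : d = n := by
  obtain ⟨U₁, hU₁, V₁, hV₁, hx₁, e₁, h₁⟩ := hd.exists_isStandardSmoothOfRelativeDimension x
  obtain ⟨U₂, hU₂, V₂, hV₂, hx₂, e₂, h₂⟩ := hn.exists_isStandardSmoothOfRelativeDimension x
  have hPa : ∀ m, RingHom.StableUnderCompositionWithLocalizationAwayTarget
      (@RingHom.IsStandardSmoothOfRelativeDimension m) := fun m ↦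
    (RingHom.isStandardSmoothOfRelativeDimension_stableUnderCompositionWithLocalizationAway m).right
  have hPl : ∀ m, RingHom.LocalizationAwayPreserves
      (@RingHom.IsStandardSmoothOfRelativeDimension m) := fun m ↦
    (RingHom.isStandardSmoothOfRelativeDimension_localizationPreserves m).away
  obtain ⟨r, s, hxs, e, h₂'⟩ := exists_basicOpen_le_appLE_of_appLE_of_isAffine (hPa n) (hPl n)
    x ⟨U₁, hU₁⟩ ⟨U₂, hU₂⟩ ⟨V₁, hV₁⟩ ⟨V₂, hV₂⟩ hx₁ hx₂ e₂ h₂ (e₁ hx₁)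
  have h₁' := appLE_basicOpen_of_appLE h (hPa d) (hPl d) ⟨U₁, hU₁⟩ ⟨V₁, hV₁⟩ e₁ h₁ r s e
  haveI : Nontrivial Γ(X, X.basicOpen s) := nontrivial_sections_of_mem hxs
  set φ := (h.appLE (S.basicOpen r) (X.basicOpen s) e).hom
  algebraize [φ]
  have hrd := Algebra.IsStandardSmoothOfRelativeDimension.rank_kaehlerDifferential
    (R := Γ(S, S.basicOpen r)) (S := Γ(X, X.basicOpen s)) d
  have hrn := Algebra.IsStandardSmoothOfRelativeDimension.rank_kaehlerDifferential
    (R := Γ(S, S.basicOpen r)) (S := Γ(X, X.basicOpen s)) n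
  exact_mod_cast hrd.symm.trans hrn

end Charts

/-! ### Spreading out relative dimension `n` from a flat base change -/

section Spread

variable {X X' S S' : Scheme.{u}} {f : X ⟶ S} {f' : X' ⟶ S'} {pr : X' ⟶ X} {i : S' ⟶ S}

/-- Base change of a chart: if `f|_V : V → U` is smooth of relative dimension `d`, so is the
restriction of the base change `f'` to the preimages. [folklore] -/
theorem smoothOfRelativeDimension_resLE_of_isPullback (H : IsPullback pr f' f i) {d : ℕ}
    {US : S.Opens} {UX : X.Opens} (e : UX ≤ f ⁻¹ᵁ US)
    (h : SmoothOfRelativeDimension d (f.resLE US UX e)) :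
    SmoothOfRelativeDimension d (f'.resLE (i ⁻¹ᵁ US) (pr ⁻¹ᵁ UX ⊓ f' ⁻¹ᵁ (i ⁻¹ᵁ US))
      (by simp)) := by
  have := smoothOfRelativeDimension_isStableUnderBaseChange (n := d)
  exact MorphismProperty.of_isPullback
    (Scheme.Hom.isPullback_resLE H (US := US) (UT := i ⁻¹ᵁ US) (UX := UX) le_rfl e rfl) h

/-- **Spreading out smoothness of relative dimension `n` from a flat base change which is
surjective on stalks.** Let `X' = X ×_S S'` with `i : S' → S` flat and surjective on stalks
(e.g. `Spec K → Spec R` for a localization `K` of `R`, such as the fraction field of a domain: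
then `X'` is the generic fibre), `f : X → S` locally of finite presentation, and assume the base
change `f' : X' → S'` is smooth of relative dimension `n`. Then every point of `X` in the image
of `X'` has a chart `Γ(S, U) → Γ(X, V)` standard smooth of relative dimension `n`. (Smoothness
at the point: the stalk map of `f` there is isomorphic to a stalk map of `f'`; the dimension of
a standard smooth chart at the point is forced to be `n` by base changing the chart to `X'` and
comparing with `f'`, `eq_of_smoothOfRelativeDimension`.) This is the pointwise form of Stacks,
Tags 0C0C and 0EY2 (descent of "smooth of relative dimension `n`" through a limit) for the limit
`Spec K = lim Spec R[1/a]` that is used to spread out smooth varieties. [cite: StacksProject, Tags 0C0C and 0EY2 (pointwise form)] -/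
theorem exists_appLE_isStandardSmoothOfRelativeDimension_of_isPullback (H : IsPullback pr f' f i)
    [LocallyOfFinitePresentation f] [Flat i] [SurjectiveOnStalks i] {n : ℕ}
    [hn : SmoothOfRelativeDimension n f'] (x' : X') :
    ∃ (U : S.affineOpens) (V : X.affineOpens) (_ : pr x' ∈ V.1) (e : V.1 ≤ f ⁻¹ᵁ U.1),
      (f.appLE U V e).hom.IsStandardSmoothOfRelativeDimension n := by
  haveI : Smooth f' := SmoothOfRelativeDimension.smooth n f'
  have hx' : x' ∈ f'.smoothLocus := by
    rw [Scheme.Hom.smoothLocus_eq_top]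
    trivial
  have hx := mem_smoothLocus_of_isPullback H hx'
  obtain ⟨d, U, V, hxV, e, hd⟩ :=
    exists_appLE_isStandardSmoothOfRelativeDimension_of_mem_smoothLocus f hx
  obtain rfl : d = n := by
    have h1 := smoothOfRelativeDimension_resLE_of_isPullback H e
      (SmoothSpread.smoothOfRelativeDimension_resLE f U V e hd)
    have h2 : SmoothOfRelativeDimension n
        (f'.resLE (i ⁻¹ᵁ U.1) (pr ⁻¹ᵁ V.1 ⊓ f' ⁻¹ᵁ (i ⁻¹ᵁ U.1)) (by simp)) :=
      IsZariskiLocalAtSource.resLE (P := @SmoothOfRelativeDimension n) _ hn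
    have hmem : x' ∈ pr ⁻¹ᵁ V.1 ⊓ f' ⁻¹ᵁ (i ⁻¹ᵁ U.1) := by
      refine ⟨hxV, ?_⟩
      change f' x' ∈ i ⁻¹ᵁ U.1
      rw [Scheme.Hom.mem_preimage, ← Scheme.Hom.comp_apply, ← H.w, Scheme.Hom.comp_apply]
      exact e hxV
    exact SmoothSpread.eq_of_smoothOfRelativeDimension _ (hd := h1) (hn := h2) ⟨x', hmem⟩
  exact ⟨U, V, hxV, e, hd⟩

end Spread

/-! ### The locus where `f` is smooth of relative dimension `n` -/

section GoodLocus

variable {X S : Scheme.{u}} (n : ℕ) (f : X ⟶ S)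

/-- `f` is smooth of relative dimension `n` on the union of any family of opens on which it is
(smoothness of relative dimension `n` is local on the source). Applied to the family of *all*
such opens this gives the maximal open `W ⊆ X` — the good locus — with `W → S` smooth of
relative dimension `n`. [folklore] -/
theorem smoothOfRelativeDimension_sSup_ι_comp (𝒮 : Set X.Opens)
    (h𝒮 : ∀ V ∈ 𝒮, SmoothOfRelativeDimension n (V.ι ≫ f)) :
    SmoothOfRelativeDimension n ((sSup 𝒮).ι ≫ f) := by
  set W := sSup 𝒮 with hW
  let ιV : 𝒮 → W.toScheme.Opens := fun V ↦ W.ι ⁻¹ᵁ V.1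
  have htop : ⨆ V, ιV V = ⊤ := by
    refine top_le_iff.mp fun x _ ↦ ?_
    have hx : x.1 ∈ sSup 𝒮 := x.2
    rw [sSup_eq_iSup', TopologicalSpace.Opens.mem_iSup] at hx
    obtain ⟨V, hxV⟩ := hx
    exact TopologicalSpace.Opens.mem_iSup.mpr ⟨V, hxV⟩
  rw [IsZariskiLocalAtSource.iff_of_iSup_eq_top (P := @SmoothOfRelativeDimension n) ιV htop]
  rintro ⟨V, hV⟩
  have hVW : V ≤ W := le_sSup hV
  have hrange : Set.range ⇑((W.ι ⁻¹ᵁ V).ι ≫ W.ι) = Set.range ⇑V.ι := by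
    rw [Scheme.Hom.comp_base, TopCat.coe_comp, Set.range_comp, Scheme.Opens.range_ι,
      Scheme.Opens.range_ι]
    change ⇑W.ι '' (⇑W.ι ⁻¹' (V : Set X)) = (V : Set X)
    rw [Set.image_preimage_eq_inter_range, Scheme.Opens.range_ι]
    exact Set.inter_eq_left.mpr hVW
  let e := IsOpenImmersion.isoOfRangeEq ((W.ι ⁻¹ᵁ V).ι ≫ W.ι) V.ι hrange
  have he : e.hom ≫ V.ι = (W.ι ⁻¹ᵁ V).ι ≫ W.ι := IsOpenImmersion.isoOfRangeEq_hom_fac _ _ _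
  change SmoothOfRelativeDimension n ((W.ι ⁻¹ᵁ V).ι ≫ W.ι ≫ f)
  rw [← Category.assoc, ← he, Category.assoc]
  exact (MorphismProperty.cancel_left_of_respectsIso (@SmoothOfRelativeDimension n) _ _).mpr
    (h𝒮 V hV)

variable {n f} in
/-- A chart `Γ(S, U) → Γ(X, V)` standard smooth of relative dimension `n` makes `V → X → S`
smooth of relative dimension `n`. [folklore] -/
theorem smoothOfRelativeDimension_ι_comp_of_appLE (U : S.affineOpens) (V : X.affineOpens)
    (e : V.1 ≤ f ⁻¹ᵁ U.1) (h : (f.appLE U V e).hom.IsStandardSmoothOfRelativeDimension n) :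
    SmoothOfRelativeDimension n (V.1.ι ≫ f) := by
  haveI h1 := SmoothSpread.smoothOfRelativeDimension_resLE f U V e h
  rw [← Scheme.Hom.resLE_comp_ι f e]
  exact inferInstanceAs (SmoothOfRelativeDimension (n + 0) (f.resLE U V e ≫ U.1.ι))

variable {n f} in
/-- If `f` is smooth of relative dimension `n` on an open `W ⊆ X` and a base change
`X_T = X ×_S T → X` lands in `W`, then `X_T → T` is smooth of relative dimension `n` (it is the
base change of `W → S`). [folklore] -/
theorem smoothOfRelativeDimension_of_range_subset {W : X.Opens}
    (hW : SmoothOfRelativeDimension n (W.ι ≫ f)) {T XT : Scheme.{u}} {t : T ⟶ S}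
    {prT : XT ⟶ X} {fT : XT ⟶ T} (H : IsPullback prT fT f t)
    (h : Set.range ⇑prT ⊆ (W : Set X)) : SmoothOfRelativeDimension n fT := by
  have hsq := (isPullback_morphismRestrict prT W).paste_vert H
  have := smoothOfRelativeDimension_isStableUnderBaseChange (n := n)
  have h1 : SmoothOfRelativeDimension n ((prT ⁻¹ᵁ W).ι ≫ fT) :=
    MorphismProperty.of_isPullback hsq hW
  have htop : prT ⁻¹ᵁ W = ⊤ := top_le_iff.mp fun x _ ↦ h ⟨x, rfl⟩
  rw [IsZariskiLocalAtSource.iff_of_iSup_eq_top (P := @SmoothOfRelativeDimension n)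
    (fun _ : Unit ↦ prT ⁻¹ᵁ W) (by rw [htop]; exact iSup_const)]
  exact fun _ ↦ h1

variable {n f} in
/-- Points of `X` lying over points in the image of `i : S' → S` lift to `X ×_S S'`. [folklore] -/
theorem exists_eq_of_isPullback {X' S' : Scheme.{u}} {f' : X' ⟶ S'} {pr : X' ⟶ X} {i : S' ⟶ S}
    (H : IsPullback pr f' f i) (x : X) (s' : S') (h : f x = i s') : ∃ x', pr x' = x := by
  obtain ⟨z, hz, -⟩ := Scheme.Pullback.exists_preimage_pullback x s' h
  exact ⟨H.isoPullback.inv z, by rw [← hz, ← Scheme.Hom.comp_apply, IsPullback.isoPullback_inv_fst]⟩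

variable {f} in
/-- **The fibres of `f` over the image of a flat `i : S' → S` surjective on stalks are covered by
opens on which `f` is smooth of relative dimension `n`, as soon as the base change of `f` to `S'`
is smooth of relative dimension `n`** (combine
`exists_appLE_isStandardSmoothOfRelativeDimension_of_isPullback` and
`smoothOfRelativeDimension_ι_comp_of_appLE`). For `i = (Spec K → Spec R)`, `K = Frac R`: if the
generic fibre is smooth of relative dimension `n`, the locus where `f` is smooth of relative
dimension `n` contains the generic fibre (Stacks, Tags 0C0C and 0EY2, pointwise form).
[cite: StacksProject, Tags 0C0C and 0EY2 (pointwise form)] -/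
theorem exists_smoothOfRelativeDimension_ι_comp_of_isPullback {X' S' : Scheme.{u}}
    {f' : X' ⟶ S'} {pr : X' ⟶ X} {i : S' ⟶ S} (H : IsPullback pr f' f i)
    [LocallyOfFinitePresentation f] [Flat i] [SurjectiveOnStalks i]
    [SmoothOfRelativeDimension n f'] (x : X) (s' : S') (h : f x = i s') :
    ∃ V : X.Opens, SmoothOfRelativeDimension n (V.ι ≫ f) ∧ x ∈ V := by
  obtain ⟨x', rfl⟩ := exists_eq_of_isPullback H x s' h
  obtain ⟨U, V, hxV, e, hV⟩ :=
    exists_appLE_isStandardSmoothOfRelativeDimension_of_isPullback (n := n) H x'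
  exact ⟨V.1, smoothOfRelativeDimension_ι_comp_of_appLE U V e hV, hxV⟩

end GoodLocus

end Literature.AlgebraicGeometry.Motives

end
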